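import Mathlib
import HarnessLib

/-!
# Incomplete Eisenstein series on `SL(2,ℤ)\ℍ` and their averages over closed horocycles

Support file for the discharge of the named facts `Literature.NumberTheory.LFunctions.quasiRH_of_horocycleRate` and
`Literature.NumberTheory.LFunctions.riemannHypothesis_of_horocycleRate_threeQuarters` (Zagier 1981, §1 pp. 279–280;
`Literature/NumberTheory/LFunctions/HorocycleRH.lean`, proofs in `HorocycleRHProofs.lean`).

## Part 1. The test functions

For a bump `ψ : ℝ → ℝ` supported in `[a, b] ⊂ (0, ∞)` we define the (doubled) *incomplete
Eisenstein series*
`incEis ψ z = ∑_{(c,d) ∈ ℤ², gcd(c,d)=1} ψ (im z / |c z + d|²) = 2 E(z | ψ) = 2 ∑_{γ ∈ Γ∞\Γ} ψ(im γz)`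
(Iwaniec, *Spectral methods of automorphic forms*, §3.2 and (7.12); Zagier 1981 §1 uses the
Rankin–Selberg unfolding of exactly these sums). We prove the three properties required of a
test function by the rate predicate `Literature.NumberTheory.LFunctions.HorocycleRate`:
* `contDiffOn_incEis` : `incEis ψ` is `C^∞` on `{im > 0}` (the sum is locally finite);
* `incEis_smul` : `incEis ψ (g • z) = incEis ψ z` for `g ∈ SL(2,ℤ)` (reindex `v ↦ v g`, Mathlib's
  `EisensteinSeries.gammaSetEquiv`);
* `incEis_eq_zero_of_lt_im` : `incEis ψ z = 0` once `im z > max b (1/a)`.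
We also record the finite-sum expression on horizontal boxes (`incEis_eq_finsetSum`).

Design: the index set is Mathlib's `EisensteinSeries.gammaSet 1 1 0` (coprime pairs
`v : Fin 2 → ℤ`); `incEis ψ : ℂ → ℂ` is real-valued, cast to `ℂ`, and only its values on
`{im > 0}` matter.

## Part 2. Unfolding the horocycle average

For `ψ` continuous and supported in `[a, ∞)`, `a > 0`, we compute the average over the closed
horocycle at height `y > 0` (the classical unfolding of the double coset decomposition
`Γ∞\Γ/Γ∞`, Iwaniec §2.4 and §3.4; Zagier 1981 §1 (10)):
`∫₀¹ incEis ψ (x + iy) dx = 2 ψ(y) + 2 ∑_{c ≥ 1} φ(c) g_c(y)`,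
`g_c(y) = ∫_ℝ ψ (y / (c² (u² + y²))) du` (`horocycleAverage_incEis`): the pairs `(0, ±1)` give
`2ψ(y)`, and for `c ≥ 1` the sum over `d` coprime to `c` of `∫₀¹ ψ(y/((cx+d)²+c²y²)) dx` is
regrouped by `d = cq + r`, the `q`-sum tiles `ℝ`, and the `φ(c)` residues `r` each contribute
`∫_ℝ ψ(y/(c²(u²+y²))) du`. Everything is a finite sum (only `c² ≤ 1/(ay)`, `|d| ≪ 1` contribute).

## References
* D. Zagier, *Eisenstein series and the Riemann zeta function*, in: Automorphic forms,
  representation theory and arithmetic (Bombay 1979), Springer 1981, 275–301, §1.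
* H. Iwaniec, *Spectral methods of automorphic forms*, 2nd ed., AMS GSM 53 (2002), §2.4, §3.2,
  §3.4, §7.1.
-/

noncomputable section

open Complex EisensteinSeries MeasureTheory
open scoped MatrixGroups UpperHalfPlane

namespace Literature.NumberTheory.LFunctions

/-- The index set of the incomplete Eisenstein series: coprime pairs `(c, d)`, as Mathlib's
`EisensteinSeries.gammaSet 1 1 0`. [folklore] -/
abbrev coprimePairs : Set (Fin 2 → ℤ) := EisensteinSeries.gammaSet 1 1 0

/-- The summand `ψ (im z / |v₀ z + v₁|²)` of the incomplete Eisenstein series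
(`im (γ z) = im z / |c z + d|²` for `γ = (* *; c d)`). [folklore] -/
def incEisTerm (ψ : ℝ → ℝ) (v : Fin 2 → ℤ) (z : ℂ) : ℝ :=
  ψ (z.im / Complex.normSq ((v 0 : ℂ) * z + v 1))

/-- The (doubled) incomplete Eisenstein series `∑_{gcd(c,d)=1} ψ (im z / |c z + d|²) = 2 E(z|ψ)`
as a function `ℂ → ℂ` (real values cast to `ℂ`; only `{im > 0}` matters).
[cite: Zagier1981, §1 pp. 278–280] -/
def incEis (ψ : ℝ → ℝ) (z : ℂ) : ℂ :=
  ((∑' v : coprimePairs, incEisTerm ψ v.1 z : ℝ) : ℂ)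

/-- The box `{v : |v₀| ≤ N, |v₁| ≤ N}` as a finset. [folklore] -/
def pairBox (N : ℕ) : Finset (Fin 2 → ℤ) :=
  Fintype.piFinset fun _ : Fin 2 => Finset.Icc (-(N : ℤ)) N

/-- Membership in `pairBox N`. [folklore] -/
theorem mem_pairBox {N : ℕ} {v : Fin 2 → ℤ} : v ∈ pairBox N ↔ ∀ i, |v i| ≤ (N : ℤ) := by
  simp [pairBox, Fintype.mem_piFinset, abs_le]

/-- `|v₀ z + v₁|² = (v₀ re z + v₁)² + (v₀ im z)²`. [folklore] -/
theorem normSq_linear (v : Fin 2 → ℤ) (z : ℂ) :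
    Complex.normSq ((v 0 : ℂ) * z + v 1) = ((v 0 : ℝ) * z.re + v 1) ^ 2 + ((v 0 : ℝ) * z.im) ^ 2 := by
  rw [Complex.normSq_apply]
  simp only [add_re, mul_re, intCast_re, intCast_im, zero_mul, sub_zero, add_im, mul_im, add_zero]
  ring

variable {ψ : ℝ → ℝ} {a b : ℝ}

/-- If the summand at `v` does not vanish at `z` (`im z > 0`) and `ψ` vanishes on `(-∞, a)`,
`a > 0`, then `|v₀ z + v₁|² ≤ im z / a`. [folklore] -/
theorem normSq_le_of_incEisTerm_ne_zero (ha : 0 < a) (hψ : ∀ t, ψ t ≠ 0 → a ≤ t)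
    {v : Fin 2 → ℤ} {z : ℂ} (h : incEisTerm ψ v z ≠ 0) :
    Complex.normSq ((v 0 : ℂ) * z + v 1) ≤ z.im / a := by
  have hq := hψ _ h
  have hq0 : 0 < Complex.normSq ((v 0 : ℂ) * z + v 1) := by
    rcases (Complex.normSq_nonneg ((v 0 : ℂ) * z + v 1)).eq_or_lt with h0 | h0
    · rw [← h0, div_zero] at hq; exact absurd hq (not_le.mpr ha)
    · exact h0
  rw [le_div_iff₀ ha]
  rw [le_div_iff₀ hq0] at hq
  linarith [mul_comm a (Complex.normSq ((v 0 : ℂ) * z + v 1))]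

/-- Bounds on the contributing pairs: `v₀² (im z)² ≤ im z / a` and `(v₀ re z + v₁)² ≤ im z / a`.
[folklore] -/
theorem sq_le_of_incEisTerm_ne_zero (ha : 0 < a) (hψ : ∀ t, ψ t ≠ 0 → a ≤ t)
    {v : Fin 2 → ℤ} {z : ℂ} (h : incEisTerm ψ v z ≠ 0) :
    ((v 0 : ℝ) * z.im) ^ 2 ≤ z.im / a ∧ ((v 0 : ℝ) * z.re + v 1) ^ 2 ≤ z.im / a := by
  have := normSq_le_of_incEisTerm_ne_zero ha hψ h
  rw [normSq_linear] at this
  constructor <;> nlinarith [sq_nonneg ((v 0 : ℝ) * z.re + v 1), sq_nonneg ((v 0 : ℝ) * z.im)]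

/-- `|n| ≤ n²` for integers (cast to `ℝ`). [folklore] -/
theorem int_abs_le_sq (n : ℤ) : (|(n : ℝ)|) ≤ (n : ℝ) ^ 2 := by
  have h : (|n| : ℤ) ≤ n ^ 2 := by simpa [Int.natCast_natAbs] using Int.natAbs_le_self_sq n
  have : ((|n| : ℤ) : ℝ) ≤ ((n ^ 2 : ℤ) : ℝ) := by exact_mod_cast h
  simpa [Int.cast_abs, Int.cast_pow] using this

/-- On the box `δ ≤ im z ≤ Y`, `|re z| ≤ X`, only pairs in `pairBox N` contribute, for any
`N ≥ 1/(aδ)` and `N ≥ X/(aδ) + √(Y/a)`. [folklore] -/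
theorem incEisTerm_eq_zero_of_not_mem_pairBox (ha : 0 < a) (hψ : ∀ t, ψ t ≠ 0 → a ≤ t)
    {δ X Y : ℝ} (hδ : 0 < δ) {N : ℕ} (hN₀ : 1 / (a * δ) ≤ N)
    (hN₁ : 1 / (a * δ) * X + Real.sqrt (Y / a) ≤ N) {z : ℂ} (hz₁ : δ ≤ z.im) (hz₂ : z.im ≤ Y)
    (hz₃ : |z.re| ≤ X) {v : Fin 2 → ℤ} (hv : v ∉ pairBox N) : incEisTerm ψ v z = 0 := by
  by_contra h
  obtain ⟨h₁, h₂⟩ := sq_le_of_incEisTerm_ne_zero ha hψ h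
  have hy : 0 < z.im := lt_of_lt_of_le hδ hz₁
  have hX : 0 ≤ X := le_trans (abs_nonneg _) hz₃
  -- `v₀² ≤ 1/(a δ)`
  have hv0sq : (v 0 : ℝ) ^ 2 ≤ 1 / (a * δ) := by
    have : (v 0 : ℝ) ^ 2 * z.im ≤ 1 / a := by
      have h' : (v 0 : ℝ) ^ 2 * z.im * z.im ≤ z.im / a := by nlinarith
      refine le_of_mul_le_mul_right ?_ hy
      calc (v 0 : ℝ) ^ 2 * z.im * z.im ≤ z.im / a := h'
        _ = 1 / a * z.im := by ring
    rw [le_div_iff₀ (mul_pos ha hδ)]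
    rw [le_div_iff₀ ha] at this
    calc (v 0 : ℝ) ^ 2 * (a * δ) = (v 0 : ℝ) ^ 2 * δ * a := by ring
      _ ≤ (v 0 : ℝ) ^ 2 * z.im * a := by gcongr
      _ ≤ 1 := this
  have hv0 : |(v 0 : ℝ)| ≤ 1 / (a * δ) := (int_abs_le_sq _).trans hv0sq
  have hv0N : |(v 0 : ℝ)| ≤ N := hv0.trans hN₀
  -- `|v₁| ≤ |v₀| X + √(Y/a)`
  have hsqrt : |(v 0 : ℝ) * z.re + v 1| ≤ Real.sqrt (Y / a) := by
    rw [← Real.sqrt_sq_eq_abs]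
    exact Real.sqrt_le_sqrt (h₂.trans (div_le_div_of_nonneg_right hz₂ ha.le))
  have hv1N : |(v 1 : ℝ)| ≤ N := by
    have : |(v 1 : ℝ)| ≤ |(v 0 : ℝ)| * |z.re| + |(v 0 : ℝ) * z.re + v 1| := by
      have h := abs_sub ((v 0 : ℝ) * z.re + v 1) ((v 0 : ℝ) * z.re)
      rw [add_sub_cancel_left, abs_mul] at h
      linarith
    refine this.trans (le_trans ?_ hN₁)
    gcongr
  apply hv
  rw [mem_pairBox]
  have key : ∀ i, |(v i : ℝ)| ≤ N → |v i| ≤ (N : ℤ) := fun i hi => by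
    have : ((|v i| : ℤ) : ℝ) ≤ ((N : ℤ) : ℝ) := by simpa [Int.cast_abs] using hi
    exact_mod_cast this
  intro i
  fin_cases i
  · exact key 0 hv0N
  · exact key 1 hv1N


open scoped Classical in
/-- The finset of coprime pairs in `pairBox N`. [folklore] -/
def coprimePairBox (N : ℕ) : Finset coprimePairs := (pairBox N).subtype (· ∈ coprimePairs)

/-- On the box `δ ≤ im z ≤ Y`, `|re z| ≤ X` the incomplete Eisenstein series is the finite sum
over `coprimePairBox N` (`N` as in `incEisTerm_eq_zero_of_not_mem_pairBox`). [folklore] -/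
theorem incEis_eq_finsetSum (ha : 0 < a) (hψ : ∀ t, ψ t ≠ 0 → a ≤ t) {δ X Y : ℝ} (hδ : 0 < δ)
    {N : ℕ} (hN₀ : 1 / (a * δ) ≤ N) (hN₁ : 1 / (a * δ) * X + Real.sqrt (Y / a) ≤ N) {z : ℂ}
    (hz₁ : δ ≤ z.im) (hz₂ : z.im ≤ Y) (hz₃ : |z.re| ≤ X) :
    incEis ψ z = ((∑ v ∈ coprimePairBox N, incEisTerm ψ v.1 z : ℝ) : ℂ) := by
  unfold incEis
  congr 1
  apply tsum_eq_sum
  intro v hv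
  apply incEisTerm_eq_zero_of_not_mem_pairBox ha hψ hδ hN₀ hN₁ hz₁ hz₂ hz₃
  classical
  simpa [coprimePairBox, Finset.mem_subtype] using hv

/-- A choice of `N` for given box parameters. [folklore] -/
theorem exists_pairBox_bound (a δ X Y : ℝ) :
    ∃ N : ℕ, 1 / (a * δ) ≤ N ∧ 1 / (a * δ) * X + Real.sqrt (Y / a) ≤ N :=
  ⟨⌈max (1 / (a * δ)) (1 / (a * δ) * X + Real.sqrt (Y / a))⌉₊,
    (le_max_left _ _).trans (Nat.le_ceil _), (le_max_right _ _).trans (Nat.le_ceil _)⟩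

/-- Each summand is smooth on the upper half plane (for `v ≠ 0` the form `v₀ z + v₁` does not
vanish there). [folklore] -/
theorem contDiffOn_incEisTerm (hψ : ContDiff ℝ (⊤ : ℕ∞) ψ) {v : Fin 2 → ℤ} (hv : v ≠ 0) :
    ContDiffOn ℝ (⊤ : ℕ∞) (incEisTerm ψ v) {z : ℂ | 0 < z.im} := by
  have h1 : ContDiff ℝ (⊤ : ℕ∞) (fun z : ℂ => z.im) := Complex.imCLM.contDiff
  have h2 : ContDiff ℝ (⊤ : ℕ∞) (fun z : ℂ => Complex.normSq ((v 0 : ℂ) * z + v 1)) := by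
    have : (fun z : ℂ => Complex.normSq ((v 0 : ℂ) * z + v 1)) =
        fun z => ‖(v 0 : ℂ) * z + v 1‖ ^ 2 := by
      ext z; exact Complex.normSq_eq_norm_sq _
    rw [this]
    exact (contDiff_norm_sq ℝ).comp ((contDiff_const.mul contDiff_id).add contDiff_const)
  refine hψ.comp_contDiffOn (h1.contDiffOn.div h2.contDiffOn fun z hz => ?_)
  have hvR : (fun i => (v i : ℝ)) ≠ 0 := by
    intro h; apply hv; funext i; have := congr_fun h i; simpa using this
  have hne := UpperHalfPlane.linear_ne_zero_of_im (ne_of_gt hz) hvR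
  simp only [Complex.ofReal_intCast] at hne
  exact fun h0 => hne (Complex.normSq_eq_zero.mp h0)

/-- **Smoothness**: `incEis ψ` is `C^∞` on `{im > 0}` — near each point it is a finite sum of
smooth summands (`incEis_eq_finsetSum`). [folklore] -/
theorem contDiffOn_incEis (ha : 0 < a) (hψa : ∀ t, ψ t ≠ 0 → a ≤ t)
    (hψ : ContDiff ℝ (⊤ : ℕ∞) ψ) : ContDiffOn ℝ (⊤ : ℕ∞) (incEis ψ) {z : ℂ | 0 < z.im} := by
  intro z₀ hz₀
  simp only [Set.mem_setOf_eq] at hz₀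
  obtain ⟨N, hN₀, hN₁⟩ := exists_pairBox_bound a (z₀.im / 2) (|z₀.re| + 1) (z₀.im + 1)
  set G : ℂ → ℂ := fun z => ((∑ v ∈ coprimePairBox N, incEisTerm ψ v.1 z : ℝ) : ℂ) with hG_def
  have hG : ContDiffOn ℝ (⊤ : ℕ∞) G {z : ℂ | 0 < z.im} := by
    refine Complex.ofRealCLM.contDiff.comp_contDiffOn ?_
    refine ContDiffOn.sum fun v _ => ?_
    exact contDiffOn_incEisTerm hψ (IsCoprime.ne_zero ((mem_gammaSet_one _).mp v.2))
  have hopen : IsOpen {z : ℂ | 0 < z.im} := isOpen_lt continuous_const Complex.continuous_im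
  have hU : {z : ℂ | z₀.im / 2 < z.im ∧ z.im < z₀.im + 1 ∧ |z.re| < |z₀.re| + 1} ∈ nhds z₀ := by
    refine IsOpen.mem_nhds ?_ ⟨by linarith, by linarith, by linarith⟩
    refine (isOpen_lt continuous_const Complex.continuous_im).inter
      ((isOpen_lt Complex.continuous_im continuous_const).inter
        (isOpen_lt (continuous_abs.comp Complex.continuous_re) continuous_const))
  have heq : incEis ψ =ᶠ[nhds z₀] G := by
    filter_upwards [hU] with z hz
    exact incEis_eq_finsetSum ha hψa (by positivity) hN₀ hN₁ hz.1.le hz.2.1.le hz.2.2.le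
  have hGat : ContDiffAt ℝ (⊤ : ℕ∞) G z₀ := (hG z₀ hz₀).contDiffAt (hopen.mem_nhds hz₀)
  exact (hGat.congr_of_eventuallyEq heq).contDiffWithinAt

/-- The summand transforms under `g ∈ SL(2,ℤ)` by `v ↦ v g`:
`im (g z) / |v₀ (g z) + v₁|² = im z / |(v g)₀ z + (v g)₁|²` (Mathlib
`EisensteinSeries.eisSummand_SL2_apply` at weight `1`). [folklore] -/
theorem incEisTerm_smul (ψ : ℝ → ℝ) (v : Fin 2 → ℤ) (g : SL(2, ℤ)) (z : ℍ) :
    incEisTerm ψ v ↑(g • z) = incEisTerm ψ (Matrix.vecMul v (g : Matrix (Fin 2) (Fin 2) ℤ)) ↑z := by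
  have main : (↑(g • z) : ℂ).im / Complex.normSq ((v 0 : ℂ) * ↑(g • z) + v 1) =
      (z : ℂ).im / Complex.normSq (((Matrix.vecMul v (g : Matrix (Fin 2) (Fin 2) ℤ)) 0 : ℂ) * z +
        (Matrix.vecMul v (g : Matrix (Fin 2) (Fin 2) ℤ)) 1) := by
    by_cases hv : v = 0
    · subst hv; simp
    have key := EisensteinSeries.eisSummand_SL2_apply 1 v g z
    simp only [EisensteinSeries.eisSummand, zpow_neg, zpow_one] at key
    have hD := UpperHalfPlane.denom_ne_zero (g : GL (Fin 2) ℝ) z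
    have hvR : (fun i => (v i : ℝ)) ≠ 0 := by
      intro h; apply hv; funext i; have := congr_fun h i; simpa using this
    have hA : (v 0 : ℂ) * ↑(g • z) + v 1 ≠ 0 := by
      have := UpperHalfPlane.linear_ne_zero (g • z) hvR
      simpa only [Complex.ofReal_intCast] using this
    have hB : ((Matrix.vecMul v (g : Matrix (Fin 2) (Fin 2) ℤ)) 0 : ℂ) * z +
        (Matrix.vecMul v (g : Matrix (Fin 2) (Fin 2) ℤ)) 1 ≠ 0 := by
      intro h0
      rw [h0, inv_zero, mul_zero, inv_eq_zero] at key
      exact hA key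
    have hA' : (v 0 : ℂ) * ↑(g • z) + v 1 =
        (((Matrix.vecMul v (g : Matrix (Fin 2) (Fin 2) ℤ)) 0 : ℂ) * z +
          (Matrix.vecMul v (g : Matrix (Fin 2) (Fin 2) ℤ)) 1) / UpperHalfPlane.denom (g : GL (Fin 2) ℝ) z := by
      have := congrArg (·⁻¹) key
      simp only [inv_inv, mul_inv_rev] at this
      rw [this, div_eq_mul_inv]
    rw [UpperHalfPlane.coe_im, UpperHalfPlane.coe_im, ModularGroup.im_smul_eq_div_normSq g z, hA',
      map_div₀]
    have h1 : Complex.normSq (UpperHalfPlane.denom (g : GL (Fin 2) ℝ) z) ≠ 0 :=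
      fun h => hD (Complex.normSq_eq_zero.mp h)
    have h2 : Complex.normSq (((Matrix.vecMul v (g : Matrix (Fin 2) (Fin 2) ℤ)) 0 : ℂ) * z +
        (Matrix.vecMul v (g : Matrix (Fin 2) (Fin 2) ℤ)) 1) ≠ 0 :=
      fun h => hB (Complex.normSq_eq_zero.mp h)
    field_simp
  rw [incEisTerm, incEisTerm, main]

/-- **`SL(2,ℤ)`-invariance** of the incomplete Eisenstein series: reindex the sum over coprime
pairs by `v ↦ v g` (Mathlib `EisensteinSeries.gammaSetEquiv`). [folklore] -/
theorem incEis_smul (ψ : ℝ → ℝ) (g : SL(2, ℤ)) (z : ℍ) : incEis ψ ↑(g • z) = incEis ψ ↑z := by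
  unfold incEis
  congr 1
  simp_rw [incEisTerm_smul]
  let e : coprimePairs ≃ coprimePairs :=
    (gammaSetEquiv (N := 1) (r := 1) 0 g).trans (gammaSet_one_equiv 1 _ 0)
  have he : ∀ v : coprimePairs, (e v).1 = Matrix.vecMul v.1 (g : Matrix (Fin 2) (Fin 2) ℤ) := fun v => rfl
  calc ∑' v : coprimePairs, incEisTerm ψ (Matrix.vecMul v.1 (g : Matrix (Fin 2) (Fin 2) ℤ)) (z : ℂ)
      = ∑' v : coprimePairs, incEisTerm ψ (e v).1 z := by simp_rw [he]
    _ = ∑' v : coprimePairs, incEisTerm ψ v.1 z := e.tsum_eq (fun v => incEisTerm ψ v.1 (z : ℂ))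

/-- For a coprime pair the summand vanishes once `im z > b` and `im z > 1/a` (`ψ` supported in
`[a, b]`): if `v₀ = 0` then `v₁ = ±1` and the argument is `im z > b`; if `v₀ ≠ 0` then
`|v₀ z + v₁|² ≥ (im z)²` and the argument is `≤ 1 / im z < a`. [folklore] -/
theorem incEisTerm_eq_zero_of_lt_im (ha : 0 < a) (hψa : ∀ t, ψ t ≠ 0 → a ≤ t)
    (hψb : ∀ t, ψ t ≠ 0 → t ≤ b) {v : Fin 2 → ℤ} (hv : IsCoprime (v 0) (v 1)) {z : ℂ}
    (hb : b < z.im) (ha' : 1 / a < z.im) : incEisTerm ψ v z = 0 := by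
  have hz : 0 < z.im := lt_trans (by positivity) ha'
  by_contra h
  rcases eq_or_ne (v 0) 0 with h0 | h0
  · have hu : IsUnit (v 1) := by rw [h0] at hv; exact isCoprime_zero_left.mp hv
    have h1 : Complex.normSq ((v 0 : ℂ) * z + v 1) = 1 := by
      rcases Int.isUnit_iff.mp hu with h1 | h1 <;> simp [h0, h1]
    have := hψb _ h
    rw [h1, div_one] at this
    linarith
  · obtain ⟨h₁, -⟩ := sq_le_of_incEisTerm_ne_zero ha hψa h
    have hv0 : (1 : ℝ) ≤ (v 0 : ℝ) ^ 2 := by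
      have : (1 : ℤ) ≤ (v 0) ^ 2 := by nlinarith [Int.one_le_abs h0, sq_abs (v 0)]
      exact_mod_cast this
    have h3 : z.im ^ 2 ≤ z.im / a := by
      have h₁' : (v 0 : ℝ) ^ 2 * z.im ^ 2 ≤ z.im / a := by rw [← mul_pow]; exact h₁
      nlinarith [sq_nonneg z.im]
    have h4 : z.im ≤ 1 / a := by
      rw [le_div_iff₀ ha]; rw [le_div_iff₀ ha] at h3; nlinarith
    linarith

/-- **Cusp vanishing**: `incEis ψ z = 0` for `im z > max b (1/a)`. [folklore] -/
theorem incEis_eq_zero_of_lt_im (ha : 0 < a) (hψa : ∀ t, ψ t ≠ 0 → a ≤ t)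
    (hψb : ∀ t, ψ t ≠ 0 → t ≤ b) {z : ℂ} (hb : b < z.im) (ha' : 1 / a < z.im) :
    incEis ψ z = 0 := by
  unfold incEis
  rw [tsum_congr (fun v : coprimePairs =>
    incEisTerm_eq_zero_of_lt_im ha hψa hψb ((mem_gammaSet_one _).mp v.2) hb ha'), tsum_zero]
  simp

variable {ψ : ℝ → ℝ} {a : ℝ}

/-- The row integrand `u ↦ ψ (y / (c² (u² + y²)))` (`c ≥ 1`). [folklore] -/
def rowFun (ψ : ℝ → ℝ) (c : ℕ) (y u : ℝ) : ℝ := ψ (y / ((c : ℝ) ^ 2 * (u ^ 2 + y ^ 2)))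

/-- The row integral `g_c(y) = ∫_ℝ ψ (y / (c² (u² + y²))) du`. [folklore] -/
def rowIntegral (ψ : ℝ → ℝ) (c : ℕ) (y : ℝ) : ℝ := ∫ u, rowFun ψ c y u

/-- The cell integral `T(c,d) = ∫₀¹ ψ (y / ((c x + d)² + (c y)²)) dx` of one summand over the
horocycle segment. [folklore] -/
def cellIntegral (ψ : ℝ → ℝ) (y : ℝ) (c d : ℤ) : ℝ :=
  ∫ x in (0 : ℝ)..1, ψ (y / (((c : ℝ) * x + d) ^ 2 + ((c : ℝ) * y) ^ 2))

/-- The summand on the horocycle segment: `im (x+iy) = y`, `|c(x+iy)+d|² = (cx+d)² + (cy)²`.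
[folklore] -/
theorem incEisTerm_horocycle (ψ : ℝ → ℝ) (v : Fin 2 → ℤ) (x y : ℝ) :
    incEisTerm ψ v (↑x + ↑y * I) = ψ (y / (((v 0 : ℝ) * x + v 1) ^ 2 + ((v 0 : ℝ) * y) ^ 2)) := by
  rw [incEisTerm, normSq_linear]
  simp

/-- If `ψ` vanishes below `a > 0`, a nonvanishing value `ψ (y / q) ≠ 0` with `q ≥ 0` forces
`0 < q ≤ y / a`. [folklore] -/
theorem le_div_of_apply_div_ne_zero (ha : 0 < a) (hψa : ∀ t, ψ t ≠ 0 → a ≤ t) {y q : ℝ}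
    (hq : 0 ≤ q) (h : ψ (y / q) ≠ 0) : q ≤ y / a := by
  have hq' := hψa _ h
  rcases hq.eq_or_lt with h0 | h0
  · rw [← h0, div_zero] at hq'; exact absurd hq' (not_le.mpr ha)
  rw [le_div_iff₀ ha]; rw [le_div_iff₀ h0] at hq'; linarith [mul_comm a q]

/-- Support of the row integrand: `rowFun ψ c y u ≠ 0` (with `c ≥ 1`, `y > 0`) forces
`c² (u² + y²) ≤ y / a`, hence `|u| ≤ √(y/a)` and `c² ≤ 1/(a y)`. [folklore] -/
theorem rowFun_support (ha : 0 < a) (hψa : ∀ t, ψ t ≠ 0 → a ≤ t) {c : ℕ} {y u : ℝ} (hy : 0 < y)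
    (h : rowFun ψ c y u ≠ 0) : (c : ℝ) ^ 2 * (u ^ 2 + y ^ 2) ≤ y / a :=
  le_div_of_apply_div_ne_zero ha hψa (by positivity) h

/-- `|u| ≤ √(y/a)` on the support of the row integrand (`c ≥ 1`). [folklore] -/
theorem abs_le_of_rowFun_ne_zero (ha : 0 < a) (hψa : ∀ t, ψ t ≠ 0 → a ≤ t) {c : ℕ} (hc : 1 ≤ c)
    {y u : ℝ} (hy : 0 < y) (h : rowFun ψ c y u ≠ 0) : |u| ≤ Real.sqrt (y / a) := by
  have h1 := rowFun_support ha hψa hy h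
  have hc' : (1 : ℝ) ≤ (c : ℝ) ^ 2 := by
    have : (1 : ℝ) ≤ c := by exact_mod_cast hc
    nlinarith
  rw [← Real.sqrt_sq_eq_abs]
  apply Real.sqrt_le_sqrt
  nlinarith [sq_nonneg u, sq_nonneg y]

/-- `c² ≤ 1/(ay)` if the row integrand is not identically zero. [folklore] -/
theorem sq_le_of_rowFun_ne_zero (ha : 0 < a) (hψa : ∀ t, ψ t ≠ 0 → a ≤ t) {c : ℕ}
    {y u : ℝ} (hy : 0 < y) (h : rowFun ψ c y u ≠ 0) : (c : ℝ) ^ 2 ≤ 1 / (a * y) := by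
  have h1 := rowFun_support ha hψa hy h
  have : (c : ℝ) ^ 2 * y ^ 2 ≤ y / a := by nlinarith [sq_nonneg u, sq_nonneg (c : ℝ)]
  rw [le_div_iff₀ (mul_pos ha hy)]
  rw [le_div_iff₀ ha] at this
  nlinarith

/-- For `c > N ≥ 1/(ay)` the row integrand vanishes identically, so `g_c(y) = 0`. [folklore] -/
theorem rowIntegral_eq_zero_of_lt (ha : 0 < a) (hψa : ∀ t, ψ t ≠ 0 → a ≤ t) {y : ℝ} (hy : 0 < y)
    {N : ℕ} (hN₀ : 1 / (a * y) ≤ N) {c : ℕ} (hc : N < c) : rowIntegral ψ c y = 0 := by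
  have : ∀ u, rowFun ψ c y u = 0 := fun u => by
    by_contra h
    have h1 := (sq_le_of_rowFun_ne_zero ha hψa hy h).trans hN₀
    have h2 : (N : ℝ) + 1 ≤ c := by exact_mod_cast hc
    nlinarith
  simp [rowIntegral, this]

/-- Continuity of the row integrand in `u` (`c ≥ 1`, `y ≠ 0`). [folklore] -/
theorem continuous_rowFun (hψc : Continuous ψ) {c : ℕ} (hc : 1 ≤ c) {y : ℝ} (hy : 0 < y) :
    Continuous (rowFun ψ c y) := by
  unfold rowFun
  refine hψc.comp (continuous_const.div (by fun_prop) fun u => ?_)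
  have : (0 : ℝ) < c := by exact_mod_cast hc
  positivity

/-- The row integrand has compact support, hence is integrable. [folklore] -/
theorem integrable_rowFun (ha : 0 < a) (hψa : ∀ t, ψ t ≠ 0 → a ≤ t) (hψc : Continuous ψ) {c : ℕ}
    (hc : 1 ≤ c) {y : ℝ} (hy : 0 < y) : Integrable (rowFun ψ c y) := by
  refine (continuous_rowFun hψc hc hy).integrable_of_hasCompactSupport ?_
  refine HasCompactSupport.of_support_subset_isCompact (isCompact_Icc (a := -Real.sqrt (y / a))
    (b := Real.sqrt (y / a))) fun u hu => ?_
  exact abs_le.mp (abs_le_of_rowFun_ne_zero ha hψa hc hy hu)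

/-! ### Step 1: the horocycle integral as a finite sum of cell integrals -/

open scoped Classical in
/-- `∫₀¹ incEis ψ (x+iy) dx = ∑_{v ∈ pairBox N, v coprime} T(v₀, v₁)` for `N` large (in terms of
`a` and `y`). [folklore] -/
theorem horocycle_integral_eq_boxSum (ha : 0 < a) (hψa : ∀ t, ψ t ≠ 0 → a ≤ t) (hψc : Continuous ψ)
    {y : ℝ} (hy : 0 < y) {N : ℕ} (hN₀ : 1 / (a * y) ≤ N)
    (hN₁ : 1 / (a * y) * 1 + Real.sqrt (y / a) ≤ N) :
    ∫ x in (0 : ℝ)..1, incEis ψ (↑x + ↑y * I) =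
      ((∑ v ∈ pairBox N, if IsCoprime (v 0) (v 1) then cellIntegral ψ y (v 0) (v 1) else 0 : ℝ) :
        ℂ) := by
  have hseg : ∀ x ∈ Set.uIcc (0 : ℝ) 1, incEis ψ (↑x + ↑y * I) =
      ((∑ v ∈ coprimePairBox N, incEisTerm ψ v.1 (↑x + ↑y * I) : ℝ) : ℂ) := by
    intro x hx
    rw [Set.uIcc_of_le zero_le_one] at hx
    refine incEis_eq_finsetSum ha hψa hy hN₀ hN₁ (by simp) (by simp) ?_
    simpa [abs_le] using And.intro (by linarith [hx.1]) hx.2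
  rw [intervalIntegral.integral_congr hseg, intervalIntegral.integral_ofReal]
  congr 1
  have hint : ∀ v ∈ coprimePairBox N,
      IntervalIntegrable (fun x : ℝ => incEisTerm ψ v.1 (↑x + ↑y * I)) volume 0 1 := by
    intro v _
    apply Continuous.intervalIntegrable
    simp_rw [incEisTerm_horocycle]
    have hv : v.1 ≠ 0 := IsCoprime.ne_zero ((EisensteinSeries.mem_gammaSet_one _).mp v.2)
    refine hψc.comp (continuous_const.div (by fun_prop) fun x => ?_)
    rcases eq_or_ne (v.1 0) 0 with h0 | h0
    · have h1 : v.1 1 ≠ 0 := by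
        intro h1; apply hv; ext i; fin_cases i <;> simp [h0, h1]
      have : ((v.1 1 : ℝ)) ^ 2 ≠ 0 := by positivity
      simpa [h0] using this
    · have : (0 : ℝ) < ((v.1 0 : ℝ) * y) ^ 2 := by positivity
      positivity
  rw [intervalIntegral.integral_finsetSum hint]
  unfold coprimePairBox
  rw [Finset.sum_subtype_eq_sum_filter (f := fun v => ∫ x in (0 : ℝ)..1, incEisTerm ψ v (↑x + ↑y * I)),
    Finset.sum_filter]
  refine Finset.sum_congr rfl fun v _ => ?_
  simp only [coprimePairs, EisensteinSeries.mem_gammaSet_one]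
  split_ifs
  · simp_rw [incEisTerm_horocycle]; rfl
  · rfl


/-! ### Step 2: rows -/

/-- The box sum as a double sum over `c` and `d`. [folklore] -/
theorem sum_pairBox_eq (N : ℕ) (G : ℤ → ℤ → ℝ) :
    ∑ v ∈ pairBox N, G (v 0) (v 1) =
      ∑ c ∈ Finset.Icc (-(N : ℤ)) N, ∑ d ∈ Finset.Icc (-(N : ℤ)) N, G c d := by
  rw [← Finset.sum_product (Finset.Icc (-(N : ℤ)) N) (Finset.Icc (-(N : ℤ)) N)
    (fun p : ℤ × ℤ => G p.1 p.2)]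
  refine Finset.sum_equiv (finTwoArrowEquiv ℤ) (fun v => ?_) (fun v _ => rfl)
  rw [mem_pairBox, Finset.mem_product, Finset.mem_Icc, Finset.mem_Icc, Fin.forall_fin_two, abs_le,
    abs_le]
  exact Iff.rfl

/-- The row sum `∑_{|d| ≤ N, gcd(c,d)=1} T(c,d)`. [folklore] -/
def rowSum (ψ : ℝ → ℝ) (y : ℝ) (N : ℕ) (c : ℤ) : ℝ :=
  ∑ d ∈ Finset.Icc (-(N : ℤ)) N, if IsCoprime c d then cellIntegral ψ y c d else 0

/-- `T(-c, d) = T(c, -d)`. [folklore] -/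
theorem cellIntegral_neg (ψ : ℝ → ℝ) (y : ℝ) (c d : ℤ) :
    cellIntegral ψ y (-c) d = cellIntegral ψ y c (-d) := by
  simp only [cellIntegral, Int.cast_neg]
  congr 1 with x
  ring_nf

/-- Row symmetry `rowSum (-c) = rowSum c` (reindex `d ↦ -d`). [folklore] -/
theorem rowSum_neg (ψ : ℝ → ℝ) (y : ℝ) (N : ℕ) (c : ℤ) : rowSum ψ y N (-c) = rowSum ψ y N c := by
  unfold rowSum
  refine Finset.sum_equiv (Equiv.neg ℤ) (fun d => ?_) (fun d _ => ?_)
  · simp only [Finset.mem_Icc, Equiv.neg_apply]; omega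
  · simp only [Equiv.neg_apply, IsCoprime.neg_left_iff, IsCoprime.neg_right_iff, cellIntegral_neg]

/-- A sum over `|c| ≤ N` of an even function: `h 0 + 2 ∑_{1 ≤ c ≤ N} h c`. [folklore] -/
theorem sum_Icc_symm {h : ℤ → ℝ} (hh : ∀ c, h (-c) = h c) (N : ℕ) :
    ∑ c ∈ Finset.Icc (-(N : ℤ)) N, h c = h 0 + 2 * ∑ k ∈ Finset.range N, h ((k : ℤ) + 1) := by
  have himg : Finset.Icc (-(N : ℤ)) N =
      (Finset.range (N + (N + 1))).image (fun k : ℕ => (k : ℤ) - N) := by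
    ext c
    simp only [Finset.mem_Icc, Finset.mem_image, Finset.mem_range]
    constructor
    · rintro ⟨h1, h2⟩; exact ⟨(c + N).toNat, by omega, by omega⟩
    · rintro ⟨k, hk, rfl⟩; omega
  rw [himg, Finset.sum_image (fun (k : ℕ) _ (l : ℕ) _ (hkl : (k : ℤ) - N = (l : ℤ) - N) => by omega)]
  rw [Finset.sum_range_add, Finset.sum_range_succ']
  have e1 : ∑ k ∈ Finset.range N, h ((k : ℤ) - N) = ∑ k ∈ Finset.range N, h ((k : ℤ) + 1) := by
    rw [← Finset.sum_range_reflect (fun k => h ((k : ℤ) + 1)) N]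
    refine Finset.sum_congr rfl fun k hk => ?_
    rw [Finset.mem_range] at hk
    calc h ((k : ℤ) - N) = h (-((k : ℤ) - N)) := (hh _).symm
      _ = h (((N - 1 - k : ℕ) : ℤ) + 1) := by congr 1; omega
  have e2 : ∑ k ∈ Finset.range N, h (((N + (k + 1) : ℕ) : ℤ) - N) =
      ∑ k ∈ Finset.range N, h ((k : ℤ) + 1) := by
    refine Finset.sum_congr rfl fun k _ => ?_
    congr 1; push_cast; ring
  have e3 : h (((N + 0 : ℕ) : ℤ) - N) = h 0 := by congr 1; push_cast; ring
  rw [e1, e2, e3]; ring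

/-- The row `c = 0`: only `d = ±1` are coprime to `0`, each contributing `ψ(y)`. [folklore] -/
theorem rowSum_zero (ψ : ℝ → ℝ) (y : ℝ) {N : ℕ} (hN : 1 ≤ N) : rowSum ψ y N 0 = 2 * ψ y := by
  classical
  unfold rowSum
  have h1 : ∀ d : ℤ, IsCoprime 0 d ↔ d = 1 ∨ d = -1 := fun d => by
    rw [isCoprime_zero_left, Int.isUnit_iff]
  simp_rw [h1]
  rw [← Finset.sum_filter]
  have hfil : (Finset.Icc (-(N : ℤ)) N).filter (fun d => d = 1 ∨ d = -1) = {1, -1} := by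
    ext d
    simp only [Finset.mem_filter, Finset.mem_Icc, Finset.mem_insert, Finset.mem_singleton]
    omega
  rw [hfil]
  have hcell : ∀ d ∈ ({1, -1} : Finset ℤ), cellIntegral ψ y 0 d = ψ y := by
    intro d hd
    simp only [Finset.mem_insert, Finset.mem_singleton] at hd
    unfold cellIntegral
    rcases hd with rfl | rfl <;> simp
  rw [Finset.sum_congr rfl hcell, Finset.sum_const, Finset.card_pair (by norm_num), nsmul_eq_mul]
  push_cast
  ring

/-! ### Step 3: the rows `c ≥ 1` -/

/-- `T(c, d) = ∫_{d/c}^{d/c+1} ψ(y/(c²(u²+y²))) du` (`c ≥ 1`): substitute `u = x + d/c`.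
[folklore] -/
theorem cellIntegral_eq_rowFun_integral (ψ : ℝ → ℝ) (y : ℝ) {c : ℕ} (hc : 1 ≤ c) (d : ℤ) :
    cellIntegral ψ y c d = ∫ u in ((d : ℝ) / c)..((d : ℝ) / c + 1), rowFun ψ c y u := by
  have hc0 : (c : ℝ) ≠ 0 := (show (0 : ℝ) < c by exact_mod_cast hc).ne'
  have key : ∀ x : ℝ, ψ (y / (((c : ℝ) * x + d) ^ 2 + ((c : ℝ) * y) ^ 2)) =
      rowFun ψ c y (x + d / c) := by
    intro x
    unfold rowFun
    congr 2
    field_simp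
  unfold cellIntegral
  push_cast
  simp_rw [key]
  rw [intervalIntegral.integral_comp_add_right (fun u => rowFun ψ c y u)]
  simp [add_comm]

/-- Tiling: `∑_{k < K} ∫_{k+t}^{k+t+1} f = ∫_ℝ f` when `support f ⊆ (t, K + t]`. [folklore] -/
theorem sum_integral_unit_intervals {f : ℝ → ℝ} (hf : Continuous f) (t : ℝ) (K : ℕ)
    (hsupp : Function.support f ⊆ Set.Ioc t (K + t)) :
    ∑ k ∈ Finset.range K, ∫ u in ((k : ℝ) + t)..((k : ℝ) + t + 1), f u = ∫ u, f u := by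
  have := intervalIntegral.sum_integral_adjacent_intervals (f := f) (μ := volume)
    (a := fun k : ℕ => (k : ℝ) + t) (n := K) (fun k _ => (hf.intervalIntegrable _ _))
  simp only [Nat.cast_zero, zero_add] at this
  have e : ∀ k : ℕ, (((k + 1 : ℕ) : ℝ) + t) = (k : ℝ) + t + 1 := fun k => by push_cast; ring
  simp_rw [e] at this
  rw [this]
  exact intervalIntegral.integral_eq_integral_of_support_subset hsupp

/-- The rows `1 ≤ c ≤ N`: regroup `d = c q + r` (`0 ≤ r < c`); for each of the `φ(c)` residues
`r` coprime to `c` the `q`-sum tiles `ℝ`: `rowSum c = φ(c) g_c(y)`. [folklore] -/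
theorem rowSum_eq_totient_mul (ha : 0 < a) (hψa : ∀ t, ψ t ≠ 0 → a ≤ t) (hψc : Continuous ψ)
    {y : ℝ} (hy : 0 < y) {N : ℕ} (hN₀ : 1 / (a * y) ≤ N)
    (hN₁ : 1 / (a * y) * 1 + Real.sqrt (y / a) ≤ N) {c : ℕ} (hc : 1 ≤ c) (hcN : c ≤ N) :
    rowSum ψ y N c = (Nat.totient c : ℝ) * rowIntegral ψ c y := by
  have hc0 : (0 : ℤ) < c := by exact_mod_cast hc
  have hcR : (0 : ℝ) < c := by exact_mod_cast hc
  set M : ℕ := N + 1 with hM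
  -- the summand as a function of `d`
  set G : ℤ → ℝ := fun d => if IsCoprime (c : ℤ) d then cellIntegral ψ y c d else 0 with hG
  -- `G` vanishes for `|d| > N` (box lemma)
  have hG0 : ∀ d : ℤ, (N : ℤ) < |d| → G d = 0 := by
    intro d hd
    simp only [hG]
    split_ifs with hcop
    · unfold cellIntegral
      have : ∀ x ∈ Set.uIcc (0 : ℝ) 1,
          ψ (y / ((((c : ℤ) : ℝ) * x + d) ^ 2 + (((c : ℤ) : ℝ) * y) ^ 2)) = 0 := by
        intro x hx
        rw [Set.uIcc_of_le zero_le_one] at hx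
        have hv : (![(c : ℤ), d] : Fin 2 → ℤ) ∉ pairBox N := by
          rw [mem_pairBox]; push Not; exact ⟨1, by simpa using hd⟩
        have := incEisTerm_eq_zero_of_not_mem_pairBox ha hψa hy hN₀ hN₁ (z := ↑x + ↑y * I)
          (by simp) (by simp) (by simpa [abs_le] using And.intro (by linarith [hx.1]) hx.2) hv
        rw [incEisTerm_horocycle] at this
        simpa using this
      rw [intervalIntegral.integral_congr this]
      simp
    · rfl
  -- reindex by `d = c (k - M) + r`
  set idx : ℕ × ℕ → ℤ := fun p => (c : ℤ) * ((p.1 : ℤ) - M) + p.2 with hidx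
  set P : Finset (ℕ × ℕ) := Finset.range (M + M + 1) ×ˢ Finset.range c with hP
  have hinj : Set.InjOn idx ↑P := by
    rintro ⟨k, r⟩ hkr ⟨k', r'⟩ hkr' heq
    simp only [hP, Finset.coe_product, Set.mem_prod, Finset.mem_coe, Finset.mem_range] at hkr hkr'
    simp only [hidx] at heq
    have h1 := (Int.ediv_emod_unique (a := idx (k, r)) (b := (c : ℤ)) (r := (r : ℤ))
      (q := (k : ℤ) - M) hc0).mpr ⟨by simp only [hidx]; ring, by omega, by omega⟩
    have h2 := (Int.ediv_emod_unique (a := idx (k', r')) (b := (c : ℤ)) (r := (r' : ℤ))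
      (q := (k' : ℤ) - M) hc0).mpr ⟨by simp only [hidx]; ring, by omega, by omega⟩
    have hkk : (k : ℤ) - M = k' - M := by rw [← h1.1, ← h2.1]; simp only [hidx, heq]
    have hrr : (r : ℤ) = r' := by rw [← h1.2, ← h2.2]; simp only [hidx, heq]
    simp only [Prod.mk.injEq]; omega
  have hcover : Finset.Icc (-(N : ℤ)) N ⊆ P.image idx := by
    intro d hd
    rw [Finset.mem_Icc] at hd
    rw [Finset.mem_image]
    have hdec := (Int.ediv_emod_unique hc0 (a := d) (q := d / c) (r := d % c)).mp ⟨rfl, rfl⟩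
    obtain ⟨hqr, hr0, hrc⟩ := hdec
    have hq1 : -(N : ℤ) ≤ d / c := by nlinarith
    have hq2 : d / c ≤ N := by nlinarith
    refine ⟨((d / c + M).toNat, (d % c).toNat), ?_, ?_⟩
    · simp only [hP, Finset.mem_product, Finset.mem_range]; omega
    · simp only [hidx]
      rw [Int.toNat_of_nonneg (by omega), Int.toNat_of_nonneg hr0]
      linarith
  have step1 : rowSum ψ y N c = ∑ p ∈ P, G (idx p) := by
    unfold rowSum
    rw [← Finset.sum_image hinj]
    apply Finset.sum_subset hcover
    intro d hd hd'
    apply hG0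
    rw [Finset.mem_Icc] at hd'
    rcases le_or_gt 0 d with h | h
    · rw [abs_of_nonneg h]; omega
    · rw [abs_of_neg h]; omega
  -- evaluate the summand at `idx (k, r)`
  have step2 : ∀ k r : ℕ, G (idx (k, r)) = if IsCoprime (c : ℤ) r then
      ∫ u in ((k : ℝ) + (-(M : ℝ) + r / c))..((k : ℝ) + (-(M : ℝ) + r / c) + 1), rowFun ψ c y u
      else 0 := by
    intro k r
    simp only [hG, hidx]
    have hiff : IsCoprime (c : ℤ) ((c : ℤ) * ((k : ℤ) - M) + r) ↔ IsCoprime (c : ℤ) (r : ℤ) := by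
      rw [add_comm, IsCoprime.add_mul_left_right_iff]
    by_cases hcop : IsCoprime (c : ℤ) (r : ℤ)
    · rw [if_pos (hiff.mpr hcop), if_pos hcop, cellIntegral_eq_rowFun_integral ψ y hc]
      congr 1
      · push_cast; field_simp; ring
      · push_cast; field_simp; ring
    · rw [if_neg (fun h => hcop (hiff.mp h)), if_neg hcop]
  rw [step1, hP, Finset.sum_product_right]
  simp_rw [step2]
  -- the `k`-sum tiles `ℝ`
  have step3 : ∀ r ∈ Finset.range c,
      ∑ k ∈ Finset.range (M + M + 1),
        ∫ u in ((k : ℝ) + (-(M : ℝ) + r / c))..((k : ℝ) + (-(M : ℝ) + r / c) + 1), rowFun ψ c y u =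
      rowIntegral ψ c y := by
    intro r hr
    rw [Finset.mem_range] at hr
    apply sum_integral_unit_intervals (continuous_rowFun hψc hc hy)
    intro u hu
    have hu' := abs_le.mp ((abs_le_of_rowFun_ne_zero ha hψa hc hy hu).trans
      (le_trans (by linarith [show (0:ℝ) ≤ 1 / (a * y) * 1 by positivity]) hN₁))
    have hrc : (r : ℝ) / c < 1 := by rw [div_lt_one hcR]; exact_mod_cast hr
    have hrc' : 0 ≤ (r : ℝ) / c := by positivity
    have hMN : (M : ℝ) = N + 1 := by simp [hM]
    constructor
    · nlinarith [hu'.1]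
    · push_cast; nlinarith [hu'.2]
  have step4 : ∀ r ∈ Finset.range c,
      (∑ k ∈ Finset.range (M + M + 1), if IsCoprime (c : ℤ) r then
        ∫ u in ((k : ℝ) + (-(M : ℝ) + r / c))..((k : ℝ) + (-(M : ℝ) + r / c) + 1), rowFun ψ c y u
        else 0) = if IsCoprime (c : ℤ) r then rowIntegral ψ c y else 0 := by
    intro r hr
    split_ifs with h
    · exact step3 r hr
    · simp
  -- `∑_{r < c, gcd(c,r)=1} g = φ(c) g`
  rw [Finset.sum_congr rfl step4, ← Finset.sum_filter, Finset.sum_const, nsmul_eq_mul,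
    Nat.totient_eq_card_coprime]
  congr 2
  exact congrArg Finset.card
    (Finset.filter_congr fun r _ => Nat.isCoprime_iff_coprime (m := c) (n := r))


/-! ### The horocycle average -/

/-- **Unfolded horocycle average** of the (doubled) incomplete Eisenstein series, `y > 0`:
`∫₀¹ incEis ψ (x+iy) dx = 2ψ(y) + 2 ∑_{c ≥ 1} φ(c) ∫_ℝ ψ(y/(c²(u²+y²))) du`
(the sum is finite: `g_c(y) = 0` for `c² > 1/(ay)`). This is the constant term of `2E(·|ψ)`,
cf. Zagier 1981 §1 and Iwaniec, *Spectral methods*, §3.4. [cite: Zagier1981, §1 pp. 278–280] -/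
theorem horocycleAverage_incEis (ha : 0 < a) (hψa : ∀ t, ψ t ≠ 0 → a ≤ t) (hψc : Continuous ψ)
    {y : ℝ} (hy : 0 < y) :
    ∫ x in (0 : ℝ)..1, incEis ψ (↑x + ↑y * I) =
      ((2 * ψ y + 2 * ∑' c : ℕ, (Nat.totient c : ℝ) * rowIntegral ψ c y : ℝ) : ℂ) := by
  obtain ⟨N₀, hN₀', hN₁'⟩ := exists_pairBox_bound a y 1 y
  set N := N₀ + 1 with hN
  have hN₀ : 1 / (a * y) ≤ N := hN₀'.trans (by simp [hN])
  have hN₁ : 1 / (a * y) * 1 + Real.sqrt (y / a) ≤ N := hN₁'.trans (by simp [hN])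
  have h1N : 1 ≤ N := by simp [hN]
  rw [horocycle_integral_eq_boxSum ha hψa hψc hy hN₀ hN₁]
  congr 1
  rw [sum_pairBox_eq N (fun c d => if IsCoprime c d then cellIntegral ψ y c d else 0)]
  change ∑ c ∈ Finset.Icc (-(N : ℤ)) N, rowSum ψ y N c = _
  rw [sum_Icc_symm (rowSum_neg ψ y N) N, rowSum_zero ψ y h1N]
  congr 1
  have hrow : ∀ k ∈ Finset.range N, rowSum ψ y N ((k : ℤ) + 1) =
      (Nat.totient (k + 1) : ℝ) * rowIntegral ψ (k + 1) y := by
    intro k hk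
    rw [Finset.mem_range] at hk
    have := rowSum_eq_totient_mul ha hψa hψc hy hN₀ hN₁ (c := k + 1) (by omega) (by omega)
    push_cast at this ⊢
    exact this
  rw [Finset.sum_congr rfl hrow]
  congr 1
  symm
  rw [tsum_eq_sum (s := Finset.range (N + 1)) (fun c hc => ?_), Finset.sum_range_succ']
  · simp
  · rw [Finset.mem_range, not_lt] at hc
    rw [rowIntegral_eq_zero_of_lt ha hψa hy hN₀ (by omega), mul_zero]

end Literature.NumberTheory.LFunctions
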